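import Literature.AlgebraicGeometry.AbelianSchemes.PoincareKernelReprTests
import Literature.AlgebraicGeometry.AbelianSchemes.SpecTestObjectsUnitPoint
import Literature.Algebra.Homology.KernelBaseChangeTestAlgebraTransport
import Literature.Algebra.Homology.BaseChangeComplexReprModuleResidueField
import HarnessLib

/-!
# The Grothendieck complex of the Poincaré bundle, base-changed to the local ring at `0̂`, represents the residue field in degree `≤ 1`
# ([MumfordAV1970] §13, proof of the Theorem, pp. 127–129)

Layer `Literature/AlgebraicGeometry/AbelianSchemes`, namespace `Literature.AlgebraicGeometry.AbelianSchemes.AbelianSchemeOver`.  THEOREMS ONLY (no definition,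
no named fact, no instance, no notation, no `sorry`).  Cell `hodgecm-mathlib` (D-0151), junction (c) = (ε-assembly) of the «H1-DIM-ANY-CHAR cut» (B-p04 memo
v3 §2): the hypotheses `(ε, hε, h₁)` of the entry point ★ `finrank_HOne_baseChangeComplex_residueField_eq_finrank_cotangentSpace` for
`K•_R := baseChangeComplex R K•`, `K• = grothendieckComplex A T 𝓥 𝒫_T` the Grothendieck complex (★ B-p10) of the Poincaré bundle restricted to an affine
test base `gT : T → Â` through the unit point, and `R` a local `Γ(T)`-algebra whose maximal ideal is generated by the ideal of the `K`-point `t₀` of `T` over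
the unit section (in the application `R = 𝒪_{Â,0̂}` or `Γ(V)_{𝔪_{0̂}}`).  Assembled from ★ `BaseChangeComplexReprModuleResidueField` (the algebra: kernel tests
⇒ `ε`), ★ `PoincareKernelReprTests` (the geometry on affine test objects: rank one over the unit point, no lifting off the unit point), ★
`SpecTestObjectsUnitPoint` (the test objects `Spec(R ⧸ J) → T`, `Spec κ(R) → T`) and ★ `KernelBaseChangeTestAlgebraTransport` (geometric ↔ abstract test
algebras along `ΓSpecIso`).

* **`exists_residueField_surjective_exact_lcomp_baseChange_grothendieckComplex`** — under the standing Poincaré data over `Spec K`: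
  `∃ ε : ((K•_R)⁰)^∨ →ₗ[R] κ(R)`, surjective, with `Function.Exact ((d⁰_{K•_R})^∨-precomposition) ε` — i.e. `coker((d⁰)^∨ : (K¹_R)^∨ → (K⁰_R)^∨) ≅ κ(R)`,
  Mumford's «`Hom(H, M) ≃ Hom(H, k)` for all `R`-modules … hence `M ≅ k`» (p. 128) for the module `M = coker((d⁰)^∨)` representing `N ↦ H⁰(K•_R ⊗ N)`.

HC_CM is proved only modulo the 7 printed citations until rung 0 closes; nothing here bears on a summit statement (count-neutral capital).

## References
* [MumfordAV1970] D. Mumford, *Abelian Varieties* (1970), §13, proof of the Theorem (pp. 127–129); §5 Cor. 2–3 (pp. 50–53).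
* [GortzWedhorn2023] U. Görtz, T. Wedhorn, *Algebraic Geometry II* (2023), Cor. 23.135 (p. 355).
-/

set_option autoImplicit false

open CategoryTheory CategoryTheory.Limits AlgebraicGeometry MonoidalCategory CartesianMonoidalCategory TensorProduct IsLocalRing
open scoped MonObj

noncomputable section

namespace Literature.AlgebraicGeometry.AbelianSchemes

namespace AbelianSchemeOver

open Literature.AlgebraicGeometry.Motives Literature.AlgebraicGeometry.Modules Literature.Algebra.Homology

variable {K : Type} [Field K] (A hat : AbelianSchemeOver (Spec (CommRingCat.of K))) (π : A.X ⟶ hat.X) [IsMonHom π]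
  [Flat π.left] [Surjective π.left]
  {L : A.left.Modules} (hL : HasRank L 1)
  (hε : CechPic.pullback A.unitSection (detClass (HasRank.isFiniteLocallyFree' hL)) = 1)
  (hker : ∀ (T : Over (Spec (CommRingCat.of K))) (u : T ⟶ A.X), u ≫ π = 1 ↔ A.MemKOfL L u)
  (P : (A.prodLeft hat).Modules)
  (hsock : Nonempty ((Scheme.Modules.pullback (A.X ◁ π).left).obj P ≅ A.mumfordBundle L)) (hP1 : HasRank P 1)
  -- the affine test base `T → Â`, injective on schemes, with its `K`-point `t₀` over the unit section
  (T : SchemeOver K) [IsAffine T.left] [IsNoetherianRing Γ(T.left, ⊤)] [IsLocallyNoetherian T.left] (gT : T ⟶ hat.X) [Mono gT.left]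
  (t₀ : Spec (CommRingCat.of K) ⟶ T.left) (ht₀ : t₀ ≫ gT.left = hat.unitSection) (ht₀K : t₀ ≫ T.hom = 𝟙 _)
  {κ : Type} [LinearOrder κ] [Fintype κ] (𝓥 : κ → (A.X ⊗ T).left.Opens)
  (hV : ∀ s : Finset κ, s.Nonempty → IsAffineOpen (cechOpen 𝓥 s)) (hcov : ⨆ i, 𝓥 i = ⊤)
  (hPT : HasRank ((Scheme.Modules.pullback (A.X ◁ gT).left).obj P) 1)
  [IsProper A.X.hom] [GeometricallyIntegral A.X.hom] [Flat A.X.hom] [UniversallyOpen A.X.hom]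
  -- the local ring `R` under `Γ(T)` whose maximal ideal is generated by the ideal of `t₀`
  {R : Type} [CommRing R] [Algebra Γ(T.left, ⊤) R] [IsLocalRing R] [IsNoetherianRing R]
  (hmax : (RingHom.ker t₀.appTop.hom).map (algebraMap Γ(T.left, ⊤) R) = maximalIdeal R)

include ht₀K in
omit [IsAffine T.left] [IsNoetherianRing Γ(T.left, ⊤)] [IsLocallyNoetherian T.left] [Mono gT.left] in
/-- `t₀♯ : Γ(T) → Γ(Spec K)` is surjective for a `K`-point `t₀` (`T.hom♯` is a section). [cite: MumfordAV1970, §13, proof of the Theorem (pp. 127–129)] -/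
theorem surjective_appTop_of_comp_hom_eq_id : Function.Surjective t₀.appTop.hom := by
  intro b
  refine ⟨T.hom.appTop.hom b, ?_⟩
  change (T.hom.appTop ≫ t₀.appTop) b = b
  rw [← Scheme.Hom.comp_appTop, ht₀K]
  rfl

include hmax in
omit [IsAffine T.left] [IsNoetherianRing Γ(T.left, ⊤)] [IsLocallyNoetherian T.left] [Mono gT.left] [IsNoetherianRing R] in
/-- Elements of `ker t₀♯` map into the maximal ideal of `R`. [cite: MumfordAV1970, §13, proof of the Theorem (pp. 127–129)] -/
theorem algebraMap_mem_maximalIdeal_of_appTop_eq_zero (a : Γ(T.left, ⊤)) (ha : t₀.appTop.hom a = 0) :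
    algebraMap Γ(T.left, ⊤) R a ∈ maximalIdeal R := by
  rw [← hmax]
  exact Ideal.mem_map_of_mem _ (by rwa [RingHom.mem_ker])

include hL hε hker hsock hP1 ht₀ ht₀K hmax in
/-- **`coker((d⁰_{K•_R})^∨) ≅ κ(R)`, as a surjection `ε` with `Function.Exact`** — the hypotheses `(ε, hε, h₁)` of ★
`finrank_HOne_baseChangeComplex_residueField_eq_finrank_cotangentSpace` for the Grothendieck complex of the Poincaré bundle over an affine test base
through the unit point, base-changed to a local `Γ(T)`-algebra `R` with `𝔪_R = (ker t₀♯) R`.  The two kernel tests of ★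
`exists_residueField_surjective_exact_lcomp_baseChange_of_ker_tests` are discharged geometrically: (h1) over the unit point `ker(d⁰ ⊗ κ(R)) ≅ κ(R)` (★
`nonempty_ker_grothendieckComplex_baseChange_linearEquiv_of_comp_eq_one` on `Spec κ(R) → T`); (h2) across `Spec κ(R) → Spec(R ⧸ J)` (`𝔪² ≤ J ≠ 𝔪`, a
surjective map of one-point schemes whose target leaves the unit point since `𝔪_R ⊄ J`) kernels do not lift (★ `not_forall_ker_baseChange_lifts_of_comp_ne_one`);
both moved to the abstract test algebras by ★ `finrank_ker_baseChange_eq_of_ringEquiv` / ★ `forall_ker_baseChange_lifts_iff_of_ringEquiv` along `ΓSpecIso`.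
[cite: MumfordAV1970, §13, proof of the Theorem (pp. 127–129)] [cite: GortzWedhorn2023, Cor. 23.135 (p. 355)] -/
theorem exists_residueField_surjective_exact_lcomp_baseChange_grothendieckComplex :
    ∃ ε : ((baseChangeComplex R (grothendieckComplex A.X T 𝓥 ((Scheme.Modules.pullback (A.X ◁ gT).left).obj P) hV hcov hPT)).X 0 →ₗ[R] R) →ₗ[R]
        ResidueField R,
      Function.Surjective ε ∧ Function.Exact (LinearMap.lcomp R R
        ((baseChangeComplex R (grothendieckComplex A.X T 𝓥 ((Scheme.Modules.pullback (A.X ◁ gT).left).obj P) hV hcov hPT)).d 0 1).hom) ε := by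
  have hsp := grothendieckComplex_spec A.X T 𝓥 ((Scheme.Modules.pullback (A.X ◁ gT).left).obj P) hV hcov hPT
  have hsurj := surjective_appTop_of_comp_hom_eq_id T t₀ ht₀K
  have hkerR := algebraMap_mem_maximalIdeal_of_appTop_eq_zero T t₀ hmax
  have hfg : (maximalIdeal R).FG := (isNoetherianRing_iff_ideal_fg R).mp inferInstance _
  refine exists_residueField_surjective_exact_lcomp_baseChange_of_ker_tests _ hfg (hsp.2.2.2 0) (hsp.2.2.2 1) ?_ ?_
  · /- (h1): rank one over the residue field -/
    -- the test object `Spec κ(R) → T`; it lies over the unit point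
    let φκ : Γ(T.left, ⊤) →+* ResidueField R := algebraMap Γ(T.left, ⊤) (ResidueField R)
    let Tκ : SchemeOver K := Over.mk ((Spec.map (CommRingCat.ofHom φκ) ≫ T.left.isoSpec.inv) ≫ T.hom)
    let jκ : Tκ ⟶ T := Over.homMk (Spec.map (CommRingCat.ofHom φκ) ≫ T.left.isoSpec.inv) rfl
    haveI : IsAffine Tκ.left := inferInstanceAs (IsAffine (Spec (CommRingCat.of (ResidueField R))))
    have hkφ : ∀ a, t₀.appTop.hom a = 0 → φκ a = 0 := fun a ha => by
      change algebraMap Γ(T.left, ⊤) (ResidueField R) a = 0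
      rw [IsScalarTower.algebraMap_apply Γ(T.left, ⊤) R (ResidueField R), ResidueField.algebraMap_eq, residue_eq_zero_iff]
      exact hkerR a ha
    have hj : jκ ≫ gT = 1 := hat.homMk_comp_eq_one_of_forall_apply_eq_zero T gT t₀ ht₀ φκ ht₀K hsurj hkφ
    obtain ⟨e₁⟩ := A.nonempty_ker_grothendieckComplex_baseChange_linearEquiv_of_comp_eq_one hat π hL hε P hsock T gT 𝓥 hV hcov hPT jκ hj
    letI := testAlgebra T jκ
    -- `Γ(Spec κ(R), 𝒪) ≅ κ(R)` compatibly with the structure maps, and the kernel is free of rank one over it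
    let eκ : Γ(Tκ.left, ⊤) ≃+* ResidueField R := (Scheme.ΓSpecIso (.of (ResidueField R))).commRingCatIsoToRingEquiv
    have heκ : ∀ a, eκ (algebraMap Γ(T.left, ⊤) Γ(Tκ.left, ⊤) a) = algebraMap Γ(T.left, ⊤) (ResidueField R) a :=
      fun a => ΓSpecIso_hom_testRingHom T φκ a
    rw [← finrank_ker_baseChange_eq_of_ringEquiv _ eκ heκ, e₁.finrank_eq, Module.finrank_self]
  · /- (h2): no lifting across `Spec κ(R) → Spec(R ⧸ J)` for `𝔪² ≤ J ≠ 𝔪` -/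
    intro J p hJ hJne hp H
    -- `J` is proper (else `p` cannot lift `residue`), hence `J ≤ 𝔪`
    have hJtop : J ≠ ⊤ := by
      intro hJtop
      have h1 : p (Submodule.Quotient.mk 1) = 1 := by rw [hp, map_one]
      have h0 : (Submodule.Quotient.mk 1 : R ⧸ J) = 0 := by
        rw [Ideal.Quotient.mk_eq_mk, Ideal.Quotient.eq_zero_iff_mem, hJtop]; exact Submodule.mem_top
      rw [h0, map_zero] at h1
      exact zero_ne_one h1
    have hJle : J ≤ maximalIdeal R := le_maximalIdeal hJtop
    -- the ring maps `Γ(T) → R ⧸ J → κ(R)`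
    let φJ : Γ(T.left, ⊤) →+* R ⧸ J := algebraMap Γ(T.left, ⊤) (R ⧸ J)
    let ψ : R ⧸ J →+* ResidueField R := Ideal.Quotient.lift J (residue R) fun r hr => (residue_eq_zero_iff _).mpr (hJle hr)
    have hψ : ∀ r, ψ (Ideal.Quotient.mk J r) = residue R r := fun r => Ideal.Quotient.lift_mk J _ _
    have hψp : ∀ z, ψ z = p z := by
      intro z
      obtain ⟨r, rfl⟩ := Ideal.Quotient.mk_surjective z
      rw [hψ, ← Ideal.Quotient.mk_eq_mk, hp]
    have hφJ : ∀ a, φJ a = Ideal.Quotient.mk J (algebraMap Γ(T.left, ⊤) R a) := fun a =>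
      IsScalarTower.algebraMap_apply Γ(T.left, ⊤) R (R ⧸ J) a
    -- the test objects `j' : Spec(R ⧸ J) → T` and `k : Spec κ(R) → Spec(R ⧸ J)` over `T`
    let TJ : SchemeOver K := Over.mk ((Spec.map (CommRingCat.ofHom φJ) ≫ T.left.isoSpec.inv) ≫ T.hom)
    let j' : TJ ⟶ T := Over.homMk (Spec.map (CommRingCat.ofHom φJ) ≫ T.left.isoSpec.inv) rfl
    let T₀ : SchemeOver K := Over.mk ((Spec.map (CommRingCat.ofHom (ψ.comp φJ)) ≫ T.left.isoSpec.inv) ≫ T.hom)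
    haveI : IsAffine TJ.left := inferInstanceAs (IsAffine (Spec (CommRingCat.of (R ⧸ J))))
    haveI : IsAffine T₀.left := inferInstanceAs (IsAffine (Spec (CommRingCat.of (ResidueField R))))
    let k : T₀ ⟶ TJ :=
      Over.homMk (Spec.map (CommRingCat.ofHom ψ)) (by
        change Spec.map (CommRingCat.ofHom ψ) ≫ (Spec.map (CommRingCat.ofHom φJ) ≫ T.left.isoSpec.inv) ≫ T.hom =
          (Spec.map (CommRingCat.ofHom (ψ.comp φJ)) ≫ T.left.isoSpec.inv) ≫ T.hom
        rw [← Category.assoc, ← Category.assoc (Spec.map _), ← Spec.map_comp, ← CommRingCat.ofHom_comp])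
    have hk : k ≫ j' = Over.homMk (Spec.map (CommRingCat.ofHom (ψ.comp φJ)) ≫ T.left.isoSpec.inv) rfl := by
      apply Over.OverMorphism.ext
      change Spec.map (CommRingCat.ofHom ψ) ≫ (Spec.map (CommRingCat.ofHom φJ) ≫ T.left.isoSpec.inv) =
        Spec.map (CommRingCat.ofHom (ψ.comp φJ)) ≫ T.left.isoSpec.inv
      exact specMap_comp_specMap_comp T φJ ψ T.left.isoSpec.inv
    -- `k` is surjective: `Spec(R ⧸ J)` is one point
    haveI : Surjective k.left := surjective_specMap_of_subsingleton ψ (subsingleton_primeSpectrum_quotient_of_sq_le J hJ)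
    -- `Spec κ(R) → T` lies over the unit point, `Spec(R ⧸ J) → T` does not
    have hk1 : (k ≫ j') ≫ gT = 1 := by
      rw [hk]
      exact hat.homMk_comp_eq_one_of_forall_apply_eq_zero T gT t₀ ht₀ (ψ.comp φJ) ht₀K hsurj fun a ha => by
        change ψ (φJ a) = 0
        rw [hφJ, hψ, residue_eq_zero_iff]
        exact hkerR a ha
    have hne : j' ≫ gT ≠ 1 := by
      intro h1
      apply hJne
      refine le_antisymm hJle ?_
      rw [← hmax, Ideal.map_le_iff_le_comap]
      intro a ha
      rw [RingHom.mem_ker] at ha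
      have h0 := hat.apply_eq_zero_of_homMk_comp_eq_one T gT t₀ ht₀ φJ h1 a ha
      rw [hφJ, Ideal.Quotient.eq_zero_iff_mem] at h0
      exact h0
    -- geometry: no lifting across `k` in the geometric test algebras
    have hnot := A.not_forall_ker_baseChange_lifts_of_comp_ne_one hat π hL hε hker P hsock hP1 T gT 𝓥 hV hcov hPT j' k hk1 hne
    apply hnot
    -- transport `H` from `R ⧸ J`, `κ(R)` to `Γ(Spec(R ⧸ J), 𝒪)`, `Γ(Spec κ(R), 𝒪)`
    letI i' := testAlgebra T j'
    letI i₀ := testAlgebra T (k ≫ j')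
    let e' : Γ(TJ.left, ⊤) ≃+* R ⧸ J := (Scheme.ΓSpecIso (.of (R ⧸ J))).commRingCatIsoToRingEquiv
    let e₀ : Γ(T₀.left, ⊤) ≃+* ResidueField R := (Scheme.ΓSpecIso (.of (ResidueField R))).commRingCatIsoToRingEquiv
    have he' : ∀ a, e' (algebraMap Γ(T.left, ⊤) Γ(TJ.left, ⊤) a) = algebraMap Γ(T.left, ⊤) (R ⧸ J) a :=
      fun a => ΓSpecIso_hom_testRingHom T φJ a
    have he₀ : ∀ a, e₀ (algebraMap Γ(T.left, ⊤) Γ(T₀.left, ⊤) a) = algebraMap Γ(T.left, ⊤) (ResidueField R) a := by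
      intro a
      change (Scheme.ΓSpecIso (.of (ResidueField R))).hom (toSections (k ≫ j').left.appTop.hom ⊤ a) = _
      rw [toSections_top]
      change (Scheme.ΓSpecIso (.of (ResidueField R))).hom
        ((Spec.map (CommRingCat.ofHom ψ) ≫ (Spec.map (CommRingCat.ofHom φJ) ≫ T.left.isoSpec.inv)).appTop.hom a) = _
      rw [specMap_comp_specMap_comp T φJ ψ T.left.isoSpec.inv, ΓSpecIso_hom_appTop_specMap_comp_isoSpec_inv]
      change ψ (φJ a) = _
      rw [hφJ, hψ, IsScalarTower.algebraMap_apply Γ(T.left, ⊤) R (ResidueField R), ResidueField.algebraMap_eq]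
    have htq : ∀ x, e₀ ((testAlgHom T j' (k ≫ j') k rfl).toLinearMap x) = (p.restrictScalars Γ(T.left, ⊤)) (e' x) := by
      intro x
      change (Scheme.ΓSpecIso (.of (ResidueField R))).hom (toSections (Spec.map (CommRingCat.ofHom ψ)).appTop.hom ⊤ x) = p (e' x)
      rw [toSections_top, ← hψp]
      have hnat := Scheme.ΓSpecIso_naturality (CommRingCat.ofHom ψ)
      exact congrArg (fun f => f x) (congrArg CommRingCat.Hom.hom hnat)
    exact (forall_ker_baseChange_lifts_iff_of_ringEquiv _ e' he' e₀ he₀ _ _ htq).mpr H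

end AbelianSchemeOver

end Literature.AlgebraicGeometry.AbelianSchemes

end
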